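import Summits.BirchSwinnertonDyer.BirchSwinnertonDyer.Theorems.KolyvaginDepthDoorDepthTableKuriharaExact
import Literature.NumberTheory.EllipticCurves.KuriharaNumberParity
import HarnessLib

/-!
# Route `KolyvaginDepthDoor`, crux `KolyvaginDepthSupplyKN` (stmt-BirchSwinnertonDyer-22820) —
# DEPTH TABLE v18, GENERIC (part 2 of 3): THE EXACT KURIHARA READING — the E-side and the twist side as
# IFFs, and the FINITE FALSIFIERS (Sakamoto 2022 Thm. 1.2 / 1.5 + Kim 2026 Thm. 1.11 BY NAME)

Helper file of the lead prover of line `levelone` (kdd-p1 g22; `--supports stmt-BirchSwinnertonDyer-22820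
--as helper`); it closes nothing and BSD is NOT proved by it. Sequel of `…DepthTableKuriharaExact` (the two
named inputs `hSak1`, `hSak2` and the `δ`-minimal mechanism).

* §2′ E-SIDE EXACT: `natCard_selmerGroup_le_pow_iff_kuriharaBit` («`#Sel_p(E/ℚ) ≤ p^r` ⟺ a unit mod-`p`
  Kurihara number at a cyclic level of depth `≤ r`»), `sha_inf_torsionBy_eq_bot_iff_kuriharaBit`
  («`Ш(E/ℚ)[p] = 0` ⟺ a unit at a cyclic level of depth `≤ rank E`» — `⟸` is v17's E-side, `⟹` is NEW),
  `exists_isDeltaMinimal_card_eq_rank_of_sha` (the cyclic rank certificate: `Ш(E)[p] = 0` ⟹ a `δ`-minimal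
  cyclic level of depth EXACTLY `rank E`).
* §3 TWIST-SIDE EXACT: `natCard_selmerGroup_quadraticTwist_le_iff_kuriharaBit` («`#Sel_p(E^{(d)}/ℚ) ≤ p^r`
  ⟺ a unit of ANY globally minimal model `T` of the twist at a cyclic level of depth `≤ r`», good ordinary
  reduction and surjectivity of `T` derived from `W`, no analytic-rank hypothesis on the twist).
* §5 `prime_level_of_kuriharaNumber_ne_zero_of_rootNumber_eq_neg_one` — DEPTH EXACTLY ONE on a twist of root
  number `−1` (parity, Kim Prop. 3.14 BY NAME `hPar`): a unit at a cyclic level of depth `≤ 2` sits at ONE Kolyvagin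
  prime `ℓ` — the fleet's depth-1 search on the twist is COMPLETE for the rank-two rows. FINITE FALSIFIERS: `sha_inf_torsionBy_ne_bot_of_isDeltaMinimal_rank_lt` (a `δ`-minimal cyclic level of
  `E` of depth `> rank E` certifies `Ш(E/ℚ)[p] ≠ 0` — X1 at the torsion level FAILS at `p`),
  `not_twistCondition_of_isDeltaMinimal_twist` (a `δ`-minimal cyclic level of `T` of depth `≥ rank E + 2`
  kills the twist condition `TC(E, p, K)` of g14's exact reading; `…_of_rank_lt`: with rank bounds on `E` and the
  twist a δ-minimal TRIPLE of the twist suffices for the rank-two rows). Finitely many exact modular-symbol sums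
  each (`δ̃_e` for `e ∣ d`).

READING for the instrument (observatory / kurihara fleet): by §2′–§3, if the crux's clause holds at a row
`(E, p, K)` then a unit Kurihara number of the twist model EXISTS at some cyclic level of depth `≤ rank E` —
the fleet's search is COMPLETE in the limit; and a `δ`-minimal level of excess depth is a finite NEGATIVE
certificate for the row at `(p, K)` (the crux itself is `∃ p ∃ K`). CONDITIONAL on `hKim`, `hSak1`, `hSak2`,
modularity `hnf`, Mazur `hMaz`; per `(W, p)`; nothing class-wide; BSD is NOT proved by any of this.

References: [Sakamoto2022pSelmer] R. Sakamoto, Doc. Math. 27 (2022) 1891–1922 = arXiv:2106.03370, §1 (a)–(c),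
Conj. 1.1, Thm. 1.2, Def. 1.4, Thm. 1.5, Rem. 1.6, Prop. 3.16, Cor. 4.3, Thm. 4.8; [Kim2022StructureSelmer] C.-H. Kim,
Amer. J. Math. 148 (2026) 79–129 = arXiv:2203.12159, Thm. 1.11, §1.2.2, §1.4, §6; [Kurihara2014] M. Kurihara,
Contrib. Math. Comput. Sci. 7 (2014) = arXiv:1407.2465, Thm. 1.2.3, Conj. 1.2.4; [BurungaleCastellaSkinner2025]
Thm. 1.1.2 (b); [Kato2004Asterisque] Thm. 17.4; [Mazur1978] Cor. 4.1; [WZhang2014] Lemma 8.4 (1), Thm. 9.1;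
[GrossLMS1991] Prop. 3.7 (2); [SilvermanAEC2009] X.4.2, X.5 Cor. 5.4.
-/

set_option linter.dupNamespace false

noncomputable section

open scoped Classical NumberField

namespace Summit.BirchSwinnertonDyer.BirchSwinnertonDyer.Theorems.KolyvaginDepthDoor

open Literature.NumberTheory.EllipticCurves Literature.NumberTheory.EllipticCurves.ModularForms
  WeierstrassCurve NumberField IsDedekindDomain CongruenceSubgroup
open Summit.BirchSwinnertonDyer.BirchSwinnertonDyer.Theorems

/-! ## §2′ The E-side, EXACTLY -/

/-- **`#Sel_p(E/ℚ) ≤ p^r` ⟺ a unit mod-`p` Kurihara number at a cyclic level of depth `≤ r` (for every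
admissible datum)** — the two directions `natCard_selmerGroup_le_pow_of_kuriharaBit` (Kim Thm. 1.11) and
`exists_isDeltaMinimal_of_natCard_selmerGroup_le_pow` (Sakamoto Thm. 1.2 + 1.5). `W` globally minimal,
`p ≥ 5` good ordinary, `ρ̄_{E,p}` onto, `a_p ≢ 1`, Kodaira–Néron at `p`. CONDITIONAL on the five named
facts; per curve; BSD is not proved by it. [cite: Sakamoto2022pSelmer, Thm. 1.2, Thm. 1.5, Rem. 1.6]
[cite: Kim2022StructureSelmer, Thm. 1.11] -/
theorem natCard_selmerGroup_le_pow_iff_kuriharaBit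
    (hKim : Kim2022_card_selmerGroup_le_pow_of_kuriharaNumber_ne_zero)
    (hSak1 : Sakamoto2022_card_selmerGroup_eq_pow_of_isDeltaMinimal)
    (hSak2 : Sakamoto2022_exists_cyclicLevel_kuriharaNumber_ne_zero) (hnf : exists_isNewformOf)
    (hMaz : mazur_not_dvd_maninConstant_of_odd)
    (W : WeierstrassCurve ℚ) [W.IsElliptic] [W.IsGloballyMinimal] (p : ℕ) [hp : Fact p.Prime] (h5 : 5 ≤ p)
    (hgood : W.HasGoodReductionAtPrime p) (hord : ¬ (p : ℤ) ∣ W.frobeniusTrace p)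
    (hsur : W.HasSurjectiveModNGaloisRep p) (hna : ¬ (p : ℤ) ∣ W.frobeniusTrace p - 1)
    (hKN : ∀ v : HeightOneSpectrum (𝓞 ℚ), W.HasMultiplicativeReductionAt v → ¬ p ∣ W.ordMinimalDiscriminant v)
    [iNZ : NeZero (W.conductorNorm ℤ)] (r : ℕ) :
    Nat.card (W.selmerGroup p) ≤ p ^ r ↔
      ∀ (D : ModularParametrizationData W (W.conductorNorm ℤ)), ¬ (p : ℤ) ∣ D.maninConstant →
        (∃ u : ℚ, ‖(u : ℚ_[p])‖ = 1 ∧ W.realPeriodRat = u * plusPeriod D.f) →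
        ∃ (n : ℕ) (_ : NeZero n), IsCyclicKolyvaginLevel W p n ∧ n.primeFactors.card ≤ r ∧
          ∃ ψ : (ℓ : ℕ) → (ZMod ℓ)ˣ →* Multiplicative (ZMod p),
            (∀ ℓ ∈ n.primeFactors, Function.Surjective (ψ ℓ)) ∧ kuriharaNumber D.f p n ψ ≠ 0 := by
  constructor
  · intro hle D hc hu
    obtain ⟨e, he0, he, hν, ψ, hψ, hmin⟩ :=
      exists_isDeltaMinimal_of_natCard_selmerGroup_le_pow hSak1 hSak2 W p h5 hgood hord hsur hna hKN hle D hc hu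
    exact ⟨e, he0, he, hν, ψ, hψ, hmin.ne_zero⟩
  · exact natCard_selmerGroup_le_pow_of_kuriharaBit hKim hnf hMaz W p h5 hgood hord hsur hna hKN r

/-- **E-SIDE, EXACTLY: `Ш(E/ℚ)[p] = 0` ⟺ a unit mod-`p` Kurihara number of `E` at a cyclic level of depth
`≤ rank_ℤ E(ℚ)` (for every admissible datum).** `⟸` is v17's E-side bit (Kim Thm. 1.11 + descent count);
`⟹` is NEW: Sakamoto Thm. 1.2 supplies a cyclic unit level, Thm. 1.5 pins the depth of its `δ`-minimal
divisor to `dim Sel_p(E) = rank E`. `W` globally minimal, `p ≥ 5` good ordinary, `ρ̄_{E,p}` onto,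
`a_p ≢ 1 (mod p)`, `p ∤ ord_v(Δ_min)` at multiplicative `v`. CONDITIONAL on `hKim`, `hSak1`, `hSak2`,
modularity `hnf`, Mazur `hMaz`; per curve; BSD is not proved by it.
[cite: Sakamoto2022pSelmer, Thm. 1.2, Thm. 1.5] [cite: Kim2022StructureSelmer, Thm. 1.11] [cite: SilvermanAEC2009, Thm. X.4.2] -/
theorem sha_inf_torsionBy_eq_bot_iff_kuriharaBit
    (hKim : Kim2022_card_selmerGroup_le_pow_of_kuriharaNumber_ne_zero)
    (hSak1 : Sakamoto2022_card_selmerGroup_eq_pow_of_isDeltaMinimal)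
    (hSak2 : Sakamoto2022_exists_cyclicLevel_kuriharaNumber_ne_zero) (hnf : exists_isNewformOf)
    (hMaz : mazur_not_dvd_maninConstant_of_odd)
    (W : WeierstrassCurve ℚ) [W.IsElliptic] [W.IsGloballyMinimal] (p : ℕ) [hp : Fact p.Prime] (h5 : 5 ≤ p)
    (hgood : W.HasGoodReductionAtPrime p) (hord : ¬ (p : ℤ) ∣ W.frobeniusTrace p)
    (hsur : W.HasSurjectiveModNGaloisRep p) (hna : ¬ (p : ℤ) ∣ W.frobeniusTrace p - 1)
    (hKN : ∀ v : HeightOneSpectrum (𝓞 ℚ), W.HasMultiplicativeReductionAt v → ¬ p ∣ W.ordMinimalDiscriminant v)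
    [iNZ : NeZero (W.conductorNorm ℤ)] :
    (W.sha ⊓ AddSubgroup.torsionBy W.galH1 (p : ℤ) : AddSubgroup W.galH1) = ⊥ ↔
      ∀ (D : ModularParametrizationData W (W.conductorNorm ℤ)), ¬ (p : ℤ) ∣ D.maninConstant →
        (∃ u : ℚ, ‖(u : ℚ_[p])‖ = 1 ∧ W.realPeriodRat = u * plusPeriod D.f) →
        ∃ (n : ℕ) (_ : NeZero n), IsCyclicKolyvaginLevel W p n ∧ n.primeFactors.card ≤ W.mordellWeilRank ∧
          ∃ ψ : (ℓ : ℕ) → (ZMod ℓ)ˣ →* Multiplicative (ZMod p),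
            (∀ ℓ ∈ n.primeFactors, Function.Surjective (ψ ℓ)) ∧ kuriharaNumber D.f p n ψ ≠ 0 := by
  have hirr : W.HasIrreducibleModPGaloisRep p := hasIrreducibleModPGaloisRep_of_hasSurjectiveModNGaloisRep W p hsur
  rw [← natCard_selmerGroup_le_pow_iff_kuriharaBit hKim hSak1 hSak2 hnf hMaz W p h5 hgood hord hsur hna hKN]
  constructor
  · intro hsha
    exact (natCard_selmerGroup_eq_pow_rank_of_sha_inf_torsionBy_eq_bot W p hirr hsha).le
  · exact sha_inf_torsionBy_eq_bot_of_natCard_selmerGroup_le W p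

/-- **E-SIDE, `δ`-minimal form (the cyclic rank certificate): `Ш(E/ℚ)[p] = 0` ⟹ for every admissible
datum a `δ`-minimal CYCLIC level of depth EXACTLY `rank_ℤ E(ℚ)` exists** — the cyclic-level form of
Kim's mod-`p` rank formula `rk E(ℚ) = ord(δ̃⁽¹⁾) = ν(n)` (tree fact `Kim2022_kuriharaNumber_certificate`,
there over the literal `𝒩₁`). CONDITIONAL on `hSak1`, `hSak2`; BSD is not proved by it.
[cite: Sakamoto2022pSelmer, Thm. 1.2, Thm. 1.5] [cite: Kim2022StructureSelmer, Thm. 1.11 (rank formula)] -/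
theorem exists_isDeltaMinimal_card_eq_rank_of_sha
    (hSak1 : Sakamoto2022_card_selmerGroup_eq_pow_of_isDeltaMinimal)
    (hSak2 : Sakamoto2022_exists_cyclicLevel_kuriharaNumber_ne_zero)
    (W : WeierstrassCurve ℚ) [W.IsElliptic] [W.IsGloballyMinimal] (p : ℕ) [hp : Fact p.Prime] (h5 : 5 ≤ p)
    (hgood : W.HasGoodReductionAtPrime p) (hord : ¬ (p : ℤ) ∣ W.frobeniusTrace p)
    (hsur : W.HasSurjectiveModNGaloisRep p) (hna : ¬ (p : ℤ) ∣ W.frobeniusTrace p - 1)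
    (hKN : ∀ v : HeightOneSpectrum (𝓞 ℚ), W.HasMultiplicativeReductionAt v → ¬ p ∣ W.ordMinimalDiscriminant v)
    (hsha : (W.sha ⊓ AddSubgroup.torsionBy W.galH1 (p : ℤ) : AddSubgroup W.galH1) = ⊥)
    {N : ℕ} [NeZero N] (D : ModularParametrizationData W N) (hc : ¬ (p : ℤ) ∣ D.maninConstant)
    (hu : ∃ u : ℚ, ‖(u : ℚ_[p])‖ = 1 ∧ W.realPeriodRat = u * plusPeriod D.f) :
    ∃ (e : ℕ) (_ : NeZero e), IsCyclicKolyvaginLevel W p e ∧ e.primeFactors.card = W.mordellWeilRank ∧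
      ∃ ψ : (ℓ : ℕ) → (ZMod ℓ)ˣ →* Multiplicative (ZMod p),
        (∀ ℓ ∈ e.primeFactors, Function.Surjective (ψ ℓ)) ∧ Sakamoto2024.IsDeltaMinimal D.f p e ψ := by
  have hirr : W.HasIrreducibleModPGaloisRep p := hasIrreducibleModPGaloisRep_of_hasSurjectiveModNGaloisRep W p hsur
  have hle : Nat.card (W.selmerGroup p) ≤ p ^ W.mordellWeilRank :=
    (natCard_selmerGroup_eq_pow_rank_of_sha_inf_torsionBy_eq_bot W p hirr hsha).le
  obtain ⟨e, he0, he, -, ψ, hψ, hmin⟩ :=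
    exists_isDeltaMinimal_of_natCard_selmerGroup_le_pow hSak1 hSak2 W p h5 hgood hord hsur hna hKN hle D hc hu
  have hν := (rank_le_card_primeFactors_and_sha_iff_of_isDeltaMinimal hSak1 W p h5 hgood hord hsur hna hKN D hc hu
    e he ψ hψ hmin).2.mp hsha
  exact ⟨e, he0, he, hν, ψ, hψ, hmin⟩

/-! ## §3 The twist side, EXACTLY: `#Sel_p(E^{(d)}/ℚ) ≤ p^r` ⟺ a unit of a minimal twist model at depth `≤ r` -/

/-- **TWIST SIDE, EXACTLY: `#Sel_p(E^{(d)}/ℚ) ≤ p^r` ⟺ a unit mod-`p` Kurihara number of a globally minimal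
model `T` of the twist at a cyclic level of depth `≤ r` (for every admissible datum of `T`).** `W` globally
minimal elliptic, `p ≥ 5` good ordinary for `W` with `ρ̄_{W,p}` onto, `d ≠ 0`, `p ∤ d`; `T` ANY globally
minimal model of `E^{(d)}` (`C • T = W.quadraticTwist d`) — good ordinary reduction and surjectivity of
`T` DERIVED from `W` (v16) — with `a_p(T) ≢ 1` and Kodaira–Néron for `T` at `p`; Selmer transport along `C`.
`⟸` is v17's twist side; `⟹` is NEW (§2 for `T`). NO analytic-rank hypothesis on the twist. CONDITIONAL
on the five named facts; BSD is not proved by it. [cite: Sakamoto2022pSelmer, Thm. 1.2, Thm. 1.5]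
[cite: Kim2022StructureSelmer, Thm. 1.11] [cite: SilvermanAEC2009, X.5 Cor. 5.4] -/
theorem natCard_selmerGroup_quadraticTwist_le_iff_kuriharaBit
    (hKim : Kim2022_card_selmerGroup_le_pow_of_kuriharaNumber_ne_zero)
    (hSak1 : Sakamoto2022_card_selmerGroup_eq_pow_of_isDeltaMinimal)
    (hSak2 : Sakamoto2022_exists_cyclicLevel_kuriharaNumber_ne_zero) (hnf : exists_isNewformOf)
    (hMaz : mazur_not_dvd_maninConstant_of_odd)
    (W : WeierstrassCurve ℚ) [W.IsElliptic] [W.IsGloballyMinimal] (p : ℕ) [hp : Fact p.Prime] (h5 : 5 ≤ p)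
    (hgood : W.HasGoodReductionAtPrime p) (hord : ¬ (p : ℤ) ∣ W.frobeniusTrace p)
    (hsur : W.HasSurjectiveModNGaloisRep p) {d : ℤ} (hd : d ≠ 0) (hpd : ¬ (p : ℤ) ∣ d)
    (T : WeierstrassCurve ℚ) [T.IsElliptic] [T.IsGloballyMinimal] (C : VariableChange ℚ)
    (hC : C • T = W.quadraticTwist (d : ℚ))
    (hTna : ¬ (p : ℤ) ∣ T.frobeniusTrace p - 1)
    (hTKN : ∀ v : HeightOneSpectrum (𝓞 ℚ), T.HasMultiplicativeReductionAt v → ¬ p ∣ T.ordMinimalDiscriminant v)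
    [iNZT : NeZero (T.conductorNorm ℤ)] (r : ℕ) :
    Nat.card ((W.quadraticTwist (d : ℚ)).selmerGroup p) ≤ p ^ r ↔
      ∀ (D : ModularParametrizationData T (T.conductorNorm ℤ)), ¬ (p : ℤ) ∣ D.maninConstant →
        (∃ u : ℚ, ‖(u : ℚ_[p])‖ = 1 ∧ T.realPeriodRat = u * plusPeriod D.f) →
        ∃ (m : ℕ) (_ : NeZero m), IsCyclicKolyvaginLevel T p m ∧ m.primeFactors.card ≤ r ∧
          ∃ ψ : (ℓ : ℕ) → (ZMod ℓ)ˣ →* Multiplicative (ZMod p),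
            (∀ ℓ ∈ m.primeFactors, Function.Surjective (ψ ℓ)) ∧ kuriharaNumber D.f p m ψ ≠ 0 := by
  have hpP : p.Prime := hp.out
  have hdq : (d : ℚ) ≠ 0 := by exact_mod_cast hd
  have hTsur : T.HasSurjectiveModNGaloisRep p := hasSurjectiveModNGaloisRep_of_smul_eq_quadraticTwist W T hdq hC p hsur
  have hp2d : ¬ ((p : ℤ) ∣ 2 * d) := by
    intro h
    rcases (Nat.prime_iff_prime_int.mp hpP).dvd_or_dvd h with h2 | h2
    · have : p = 2 := (Nat.prime_dvd_prime_iff_eq hpP Nat.prime_two).mp (by exact_mod_cast h2)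
      omega
    · exact hpd h2
  obtain ⟨hTgood, hTord⟩ := goodOrdinary_of_smul_eq_quadraticTwist_of_ne_zero W T hd hC p hp2d hgood hord
  rw [← natCard_selmerGroup_eq_of_variableChange (p : ℤ) hC]
  exact natCard_selmerGroup_le_pow_iff_kuriharaBit hKim hSak1 hSak2 hnf hMaz T p h5 hTgood hTord hTsur hTna hTKN r

/-! ## §5 Readings for the instrument: a finite FALSIFIER per row, and depth ONE on the twist -/

/-- **FINITE FALSIFIER, E-side: a `δ`-minimal cyclic level of `E` of depth `> rank_ℤ E(ℚ)` certifies
`Ш(E/ℚ)[p] ≠ 0`** (so KatoTransfer's X1 at the torsion level FAILS at this `p`, and the crux's clause fails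
at `(p, K)` for every `K`) — finitely many exact modular-symbol sums: the units/zeros of `δ̃_e` for `e ∣ d`.
`W` globally minimal, `p ≥ 5` good ordinary, `ρ̄_{E,p}` onto, `a_p ≢ 1`, Kodaira–Néron at `p`. CONDITIONAL
on `hSak1`; BSD is not proved by it. [cite: Sakamoto2022pSelmer, Thm. 1.5] [cite: SilvermanAEC2009, Thm. X.4.2] -/
theorem sha_inf_torsionBy_ne_bot_of_isDeltaMinimal_rank_lt
    (hSak1 : Sakamoto2022_card_selmerGroup_eq_pow_of_isDeltaMinimal)
    (W : WeierstrassCurve ℚ) [W.IsElliptic] [W.IsGloballyMinimal] (p : ℕ) [hp : Fact p.Prime] (h5 : 5 ≤ p)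
    (hgood : W.HasGoodReductionAtPrime p) (hord : ¬ (p : ℤ) ∣ W.frobeniusTrace p)
    (hsur : W.HasSurjectiveModNGaloisRep p) (hna : ¬ (p : ℤ) ∣ W.frobeniusTrace p - 1)
    (hKN : ∀ v : HeightOneSpectrum (𝓞 ℚ), W.HasMultiplicativeReductionAt v → ¬ p ∣ W.ordMinimalDiscriminant v)
    {N : ℕ} [NeZero N] (D : ModularParametrizationData W N) (hc : ¬ (p : ℤ) ∣ D.maninConstant)
    (hu : ∃ u : ℚ, ‖(u : ℚ_[p])‖ = 1 ∧ W.realPeriodRat = u * plusPeriod D.f)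
    (d : ℕ) [NeZero d] (hd : IsCyclicKolyvaginLevel W p d)
    (ψ : (ℓ : ℕ) → (ZMod ℓ)ˣ →* Multiplicative (ZMod p)) (hψ : ∀ ℓ ∈ d.primeFactors, Function.Surjective (ψ ℓ))
    (hmin : Sakamoto2024.IsDeltaMinimal D.f p d ψ) (hlt : W.mordellWeilRank < d.primeFactors.card) :
    (W.sha ⊓ AddSubgroup.torsionBy W.galH1 (p : ℤ) : AddSubgroup W.galH1) ≠ ⊥ := by
  intro hsha
  have h := (rank_le_card_primeFactors_and_sha_iff_of_isDeltaMinimal hSak1 W p h5 hgood hord hsur hna hKN D hc hu d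
    hd ψ hψ hmin).2.mp hsha
  omega

/-- **FINITE FALSIFIER, twist side: a `δ`-minimal cyclic level of a minimal twist model `T` of depth
`≥ rank E + 2` KILLS the twist condition `TC(E, p, K)`** (`#Sel_p(E^{(d)}) ≤ p^{rank E}` ∨
(`Ш(E^{(d)})[p] = 0` ∧ `rank E^{(d)} = rank E + 1`)): by Thm. 1.5 `#Sel_p(E^{(d)}) = p^{ν(m)}`; the first
disjunct would give `ν(m) ≤ rank E`, the second `ν(m) = rank E + 1`. With g14's exact reading the clause of
the crux at `(W, p, K)` then FAILS (`not_kolyvaginClass_rankClause_of_isDeltaMinimal_twist`). `d ≠ 0`,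
`p ∤ d`, `T` globally minimal with `C • T = W^{(d)}`, `a_p(T) ≢ 1`, Kodaira–Néron for `T`. CONDITIONAL on
`hSak1`; BSD is not proved by it. [cite: Sakamoto2022pSelmer, Thm. 1.5] [cite: SilvermanAEC2009, Thm. X.4.2, X.5 Cor. 5.4] -/
theorem not_twistCondition_of_isDeltaMinimal_twist
    (hSak1 : Sakamoto2022_card_selmerGroup_eq_pow_of_isDeltaMinimal)
    (W : WeierstrassCurve ℚ) [W.IsElliptic] [W.IsGloballyMinimal] (p : ℕ) [hp : Fact p.Prime] (h5 : 5 ≤ p)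
    (hgood : W.HasGoodReductionAtPrime p) (hord : ¬ (p : ℤ) ∣ W.frobeniusTrace p)
    (hsur : W.HasSurjectiveModNGaloisRep p) {d : ℤ} (hd : d ≠ 0) (hpd : ¬ (p : ℤ) ∣ d)
    (T : WeierstrassCurve ℚ) [T.IsElliptic] [T.IsGloballyMinimal] (C : VariableChange ℚ)
    (hC : C • T = W.quadraticTwist (d : ℚ))
    (hTna : ¬ (p : ℤ) ∣ T.frobeniusTrace p - 1)
    (hTKN : ∀ v : HeightOneSpectrum (𝓞 ℚ), T.HasMultiplicativeReductionAt v → ¬ p ∣ T.ordMinimalDiscriminant v)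
    {N : ℕ} [NeZero N] (D : ModularParametrizationData T N) (hc : ¬ (p : ℤ) ∣ D.maninConstant)
    (hu : ∃ u : ℚ, ‖(u : ℚ_[p])‖ = 1 ∧ T.realPeriodRat = u * plusPeriod D.f)
    (m : ℕ) [NeZero m] (hm : IsCyclicKolyvaginLevel T p m)
    (ψ : (ℓ : ℕ) → (ZMod ℓ)ˣ →* Multiplicative (ZMod p)) (hψ : ∀ ℓ ∈ m.primeFactors, Function.Surjective (ψ ℓ))
    (hmin : Sakamoto2024.IsDeltaMinimal D.f p m ψ) (hdepth : W.mordellWeilRank + 2 ≤ m.primeFactors.card) :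
    ¬ (Nat.card ((W.quadraticTwist (d : ℚ)).selmerGroup p) ≤ p ^ W.mordellWeilRank ∨
        (((W.quadraticTwist (d : ℚ)).sha ⊓ AddSubgroup.torsionBy (W.quadraticTwist (d : ℚ)).galH1 (p : ℤ) :
            AddSubgroup (W.quadraticTwist (d : ℚ)).galH1) = ⊥ ∧
          (W.quadraticTwist (d : ℚ)).mordellWeilRank = W.mordellWeilRank + 1)) := by
  have hpP : p.Prime := hp.out
  have hdq : (d : ℚ) ≠ 0 := by exact_mod_cast hd
  haveI hTw : (W.quadraticTwist (d : ℚ)).IsElliptic := W.isElliptic_quadraticTwist hdq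
  have hirr : W.HasIrreducibleModPGaloisRep p := hasIrreducibleModPGaloisRep_of_hasSurjectiveModNGaloisRep W p hsur
  have hirrT : (W.quadraticTwist (d : ℚ)).HasIrreducibleModPGaloisRep p :=
    (W.hasIrreducibleModPGaloisRep_quadraticTwist_iff hdq p).mpr hirr
  have hTsur : T.HasSurjectiveModNGaloisRep p := hasSurjectiveModNGaloisRep_of_smul_eq_quadraticTwist W T hdq hC p hsur
  have hp2d : ¬ ((p : ℤ) ∣ 2 * d) := by
    intro h
    rcases (Nat.prime_iff_prime_int.mp hpP).dvd_or_dvd h with h2 | h2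
    · have : p = 2 := (Nat.prime_dvd_prime_iff_eq hpP Nat.prime_two).mp (by exact_mod_cast h2)
      omega
    · exact hpd h2
  obtain ⟨hTgood, hTord⟩ := goodOrdinary_of_smul_eq_quadraticTwist_of_ne_zero W T hd hC p hp2d hgood hord
  have hTtam : ¬ p ∣ T.tamagawaProduct := not_dvd_tamagawaProduct_of_kodairaNeron T p h5 hTKN
  have hTnap : ¬ p ∣ T.reductionPointCount p := fun h ↦
    hTna ((dvd_reductionPointCount_iff_dvd_frobeniusTrace_sub_one T p).mp h)
  have hcardT : Nat.card (T.selmerGroup p) = p ^ m.primeFactors.card :=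
    hSak1 T p h5 ⟨hTgood, hTord⟩ hTsur hTnap hTtam D hc hu m hm ψ hψ hmin
  have hcard : Nat.card ((W.quadraticTwist (d : ℚ)).selmerGroup p) = p ^ m.primeFactors.card := by
    rw [← natCard_selmerGroup_eq_of_variableChange (p : ℤ) hC]; exact hcardT
  rintro (h1 | ⟨hsha, hrk⟩)
  · rw [hcard] at h1
    have := (Nat.pow_le_pow_iff_right hpP.one_lt).mp h1
    omega
  · have h2 := natCard_selmerGroup_eq_pow_rank_of_sha_inf_torsionBy_eq_bot _ p hirrT hsha
    rw [hcard, hrk] at h2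
    have := Nat.pow_right_injective hpP.two_le h2
    omega

/-- **FINITE FALSIFIER, twist side, with a rank bound on the twist**: a `δ`-minimal cyclic level `m` of the
minimal twist model `T` with `rank E < ν(m)` AND `rank E^{(d)} < ν(m)` kills `TC(E, p, K)` (Thm. 1.5:
`#Sel_p(E^{(d)}) = p^{ν(m)}`; the first disjunct needs `ν(m) ≤ rank E`, the second forces `ν(m) = rank E^{(d)}`).
For the rank-two rows with a rank-ONE twist (2-descent) a `δ`-minimal cyclic TRIPLE `ℓ₁ℓ₂ℓ₃` of `T` suffices
(parity excludes depth `2`). CONDITIONAL on `hSak1`; BSD is not proved by it.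
[cite: Sakamoto2022pSelmer, Thm. 1.5] [cite: SilvermanAEC2009, Thm. X.4.2, X.5 Cor. 5.4] -/
theorem not_twistCondition_of_isDeltaMinimal_twist_of_rank_lt
    (hSak1 : Sakamoto2022_card_selmerGroup_eq_pow_of_isDeltaMinimal)
    (W : WeierstrassCurve ℚ) [W.IsElliptic] [W.IsGloballyMinimal] (p : ℕ) [hp : Fact p.Prime] (h5 : 5 ≤ p)
    (hgood : W.HasGoodReductionAtPrime p) (hord : ¬ (p : ℤ) ∣ W.frobeniusTrace p)
    (hsur : W.HasSurjectiveModNGaloisRep p) {d : ℤ} (hd : d ≠ 0) (hpd : ¬ (p : ℤ) ∣ d)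
    (T : WeierstrassCurve ℚ) [T.IsElliptic] [T.IsGloballyMinimal] (C : VariableChange ℚ)
    (hC : C • T = W.quadraticTwist (d : ℚ))
    (hTna : ¬ (p : ℤ) ∣ T.frobeniusTrace p - 1)
    (hTKN : ∀ v : HeightOneSpectrum (𝓞 ℚ), T.HasMultiplicativeReductionAt v → ¬ p ∣ T.ordMinimalDiscriminant v)
    {N : ℕ} [NeZero N] (D : ModularParametrizationData T N) (hc : ¬ (p : ℤ) ∣ D.maninConstant)
    (hu : ∃ u : ℚ, ‖(u : ℚ_[p])‖ = 1 ∧ T.realPeriodRat = u * plusPeriod D.f)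
    (m : ℕ) [NeZero m] (hm : IsCyclicKolyvaginLevel T p m)
    (ψ : (ℓ : ℕ) → (ZMod ℓ)ˣ →* Multiplicative (ZMod p)) (hψ : ∀ ℓ ∈ m.primeFactors, Function.Surjective (ψ ℓ))
    (hmin : Sakamoto2024.IsDeltaMinimal D.f p m ψ) (hE : W.mordellWeilRank < m.primeFactors.card)
    (hT : (W.quadraticTwist (d : ℚ)).mordellWeilRank < m.primeFactors.card) :
    ¬ (Nat.card ((W.quadraticTwist (d : ℚ)).selmerGroup p) ≤ p ^ W.mordellWeilRank ∨
        (((W.quadraticTwist (d : ℚ)).sha ⊓ AddSubgroup.torsionBy (W.quadraticTwist (d : ℚ)).galH1 (p : ℤ) :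
            AddSubgroup (W.quadraticTwist (d : ℚ)).galH1) = ⊥ ∧
          (W.quadraticTwist (d : ℚ)).mordellWeilRank = W.mordellWeilRank + 1)) := by
  have hpP : p.Prime := hp.out
  have hdq : (d : ℚ) ≠ 0 := by exact_mod_cast hd
  haveI hTw : (W.quadraticTwist (d : ℚ)).IsElliptic := W.isElliptic_quadraticTwist hdq
  have hirr : W.HasIrreducibleModPGaloisRep p := hasIrreducibleModPGaloisRep_of_hasSurjectiveModNGaloisRep W p hsur
  have hirrT : (W.quadraticTwist (d : ℚ)).HasIrreducibleModPGaloisRep p :=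
    (W.hasIrreducibleModPGaloisRep_quadraticTwist_iff hdq p).mpr hirr
  have hTsur : T.HasSurjectiveModNGaloisRep p := hasSurjectiveModNGaloisRep_of_smul_eq_quadraticTwist W T hdq hC p hsur
  have hp2d : ¬ ((p : ℤ) ∣ 2 * d) := by
    intro h
    rcases (Nat.prime_iff_prime_int.mp hpP).dvd_or_dvd h with h2 | h2
    · have : p = 2 := (Nat.prime_dvd_prime_iff_eq hpP Nat.prime_two).mp (by exact_mod_cast h2)
      omega
    · exact hpd h2
  obtain ⟨hTgood, hTord⟩ := goodOrdinary_of_smul_eq_quadraticTwist_of_ne_zero W T hd hC p hp2d hgood hord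
  have hTtam : ¬ p ∣ T.tamagawaProduct := not_dvd_tamagawaProduct_of_kodairaNeron T p h5 hTKN
  have hTnap : ¬ p ∣ T.reductionPointCount p := fun h ↦
    hTna ((dvd_reductionPointCount_iff_dvd_frobeniusTrace_sub_one T p).mp h)
  have hcardT : Nat.card (T.selmerGroup p) = p ^ m.primeFactors.card :=
    hSak1 T p h5 ⟨hTgood, hTord⟩ hTsur hTnap hTtam D hc hu m hm ψ hψ hmin
  have hcard : Nat.card ((W.quadraticTwist (d : ℚ)).selmerGroup p) = p ^ m.primeFactors.card := by
    rw [← natCard_selmerGroup_eq_of_variableChange (p : ℤ) hC]; exact hcardT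
  rintro (h1 | ⟨hsha, hrk⟩)
  · rw [hcard] at h1
    have := (Nat.pow_le_pow_iff_right hpP.one_lt).mp h1
    omega
  · have h2 := natCard_selmerGroup_eq_pow_rank_of_sha_inf_torsionBy_eq_bot _ p hirrT hsha
    rw [hcard] at h2
    have := Nat.pow_right_injective hpP.two_le h2
    omega

/-- **Parity at modulus `p`** (Kim Prop. 3.14 / Kurihara Lemma 5.2.1 by name, `hPar`, read at `k = 1`): a
non-zero mod-`p` Kurihara number at a level `n ∈ 𝒩₁` forces `(−1)^{ν(n)} = w(E)`. Bookkeeping around the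
tree's `neg_one_pow_card_primeFactors_eq_rootNumber_of_kuriharaNumber_ne_zero` (modulus `p^k`), transporting
along `p ^ 1 = p`. [cite: Kim2022StructureSelmer, Prop. 3.14 (journal) = arXiv v3 Prop. 3.16] [cite: Kurihara2014, Lemma 5.2.1] -/
theorem neg_one_pow_card_primeFactors_eq_rootNumber_of_kuriharaNumber_modP_ne_zero
    (hPar : Kim2022_kuriharaNumber_eq_zero_of_neg_one_pow_ne_rootNumber)
    (W : WeierstrassCurve ℚ) [W.IsElliptic] [W.IsGloballyMinimal] (p : ℕ) [Fact p.Prime] (h5 : 5 ≤ p)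
    (hsur : W.HasSurjectiveModNGaloisRep p) {N : ℕ} [NeZero N] (f : CuspForm (Gamma0 N) 2) (hf : IsNewformOf W f)
    {n : ℕ} [NeZero n] (hn : Kato.IsKolyvaginProduct W p 1 n)
    (ψ : (ℓ : ℕ) → (ZMod ℓ)ˣ →* Multiplicative (ZMod p)) (hne : kuriharaNumber f p n ψ ≠ 0) :
    (-1 : ℤ) ^ n.primeFactors.card = W.rootNumber := by
  have key : ∀ (q : ℕ), p ^ 1 = q → ∀ (φ : (ℓ : ℕ) → (ZMod ℓ)ˣ →* Multiplicative (ZMod q)),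
      kuriharaNumber f q n φ ≠ 0 → (-1 : ℤ) ^ n.primeFactors.card = W.rootNumber := by
    intro q hq
    subst hq
    intro φ hφ
    exact neg_one_pow_card_primeFactors_eq_rootNumber_of_kuriharaNumber_ne_zero W p hPar h5 hsur f hf hn φ hφ
  exact key p (pow_one p) ψ hne

/-- **DEPTH EXACTLY ONE ON THE TWIST: the fleet's depth-1 search is COMPLETE for the rank-two rows.** If a
globally minimal curve `T` of root number `−1` (the Heegner twist `E^{(d_K)}` of an even-rank curve under the
Heegner hypothesis) carries a unit mod-`p` Kurihara number at a cyclic level `m` of depth `ν(m) ≤ 2`, then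
`m` is a single Kolyvagin PRIME `ℓ` (parity: `(−1)^{ν(m)} = w(T) = −1` forces `ν(m) = 1`, and a square-free
level with one prime factor is prime). With §3 (`r = rank E = 2`): the row's twist bit, IF it holds, is
witnessed by ONE Kolyvagin prime `ℓ` with `δ̃_ℓ(T) ≢ 0 (mod p)`. `p ≥ 5`, `ρ̄_{T,p}` onto, `f` the newform of
`T`. CONDITIONAL on the parity fact `hPar`; BSD is not proved by it.
[cite: Kim2022StructureSelmer, Prop. 3.14 (journal)] [cite: Kurihara2014, Lemma 5.2.1] -/
theorem prime_level_of_kuriharaNumber_ne_zero_of_rootNumber_eq_neg_one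
    (hPar : Kim2022_kuriharaNumber_eq_zero_of_neg_one_pow_ne_rootNumber)
    (T : WeierstrassCurve ℚ) [T.IsElliptic] [T.IsGloballyMinimal] (p : ℕ) [Fact p.Prime] (h5 : 5 ≤ p)
    (hsur : T.HasSurjectiveModNGaloisRep p) (hw : T.rootNumber = -1)
    {N : ℕ} [NeZero N] (f : CuspForm (Gamma0 N) 2) (hf : IsNewformOf T f)
    {m : ℕ} [NeZero m] (hm : IsCyclicKolyvaginLevel T p m) (hν : m.primeFactors.card ≤ 2)
    (ψ : (ℓ : ℕ) → (ZMod ℓ)ˣ →* Multiplicative (ZMod p)) (hne : kuriharaNumber f p m ψ ≠ 0) :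
    m.Prime ∧ IsCyclicKolyvaginLevel T p m := by
  have hsign := neg_one_pow_card_primeFactors_eq_rootNumber_of_kuriharaNumber_modP_ne_zero hPar T p h5 hsur f hf
    hm.1 ψ hne
  rw [hw] at hsign
  have hodd : Odd m.primeFactors.card := by
    by_contra h
    rw [Nat.not_odd_iff_even] at h
    rw [h.neg_one_pow] at hsign
    norm_num at hsign
  have h1 : m.primeFactors.card = 1 := by
    obtain ⟨k, hk⟩ := hodd
    omega
  refine ⟨?_, hm⟩
  have hsq : Squarefree m := hm.1.squarefree
  exact Nat.squarefree_and_prime_pow_iff_prime.mp ⟨hsq, isPrimePow_iff_card_primeFactors_eq_one.mpr h1⟩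

end Summit.BirchSwinnertonDyer.BirchSwinnertonDyer.Theorems.KolyvaginDepthDoor

end
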